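import Literature.NumberTheory.Transcendental.LinEDSCompact
import HarnessLib

/-!
# The linearised extended double shuffle system mod 2: block certificates over CELLS of columns

Third extension of the kernel-checkable rank engine `LinEDS` for Ihara–Kaneko–Zagier's linearised
extended double shuffle system [IharaKanekoZagier2006, §2, Conjecture 1] (sibling files
`LinEDS.lean` §9 depth blocks, `LinEDSGroups.lean` §10 grouped rows, `LinEDSCompact.lean` §11
compacted slots). Two costs stop the depth-block certificates at weight 17: an exact-depth block
has up to `C(15,7) = 6435` columns (one packed elimination costs `n² · W'`), and every block file
recomputes the columns of weight `k` by a pass over all `2^(k-2)` odd codes (`cols`, `colsDepth`: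
at `k = 17` one such pass with a per-column depth count is half a minute of kernel time).

Here a block is a union of CELLS. A cell `(D, [ℓ₁, ℓ₂, …])` is the set of admissible binary
words of weight `k` (first letter `x`, last letter `y`) of depth `D` whose LAST parts are
`ℓ₁` (last), `ℓ₂` (second to last), …; its bitset of codes is GENERATED by a small dynamic
programme over word lengths (`extendMask`: prepend all words with a prescribed number of `y`'s to
a seed set; `O(k²)` bitset operations, no per-column pass). The linearised rows `F(s,t)` of total
depth `D` are supported on words of depth `≤ D`, and their depth-`D` words end in the last part
`s_d` or `t_{d'}` (both words end in `y`, so trailing `x`-runs never merge; the regularisation fold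
only inserts a `y`), so ordering the columns by (depth, last part, second-to-last part, …)
lexicographically keeps the mod-2 matrix block lower triangular for much finer blocks than depth
alone — at weight 17 every block can be kept below `≈ 2000` columns. A cell block certificate for
weight `k` is a chain of blocks `(cells, later)`: `checkBlockC` verifies ONE block (its column list
`L` is exactly the block — `maskOf L = cellsMask cells ∧ colMask` —, the group rows have no bit in
the `later` cells, and the rows masked to the block and folded into width `W'` eliminate fully,
exactly as in §11), and `chainOK` verifies the chain (every later block lies inside the `later` set
of every earlier block, and the blocks together cover `colMask k`). Nothing about the MEANING of a
cell is used by the soundness argument (Summit-side master theorem): only these Boolean facts.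

References: K. Ihara, M. Kaneko, D. Zagier, Compos. Math. 142 (2006) 307–338, §2, Conjecture 1
[IharaKanekoZagier2006]; M. Kaneko, M. Noro, K. Tsurumaki, IMA Vol. Math. Appl. 148 (2008) 47–58
(ranks of the EDS matrix modulo a prime, to weight 20).
-/

namespace Literature.NumberTheory.Transcendental

namespace LinEDS

/-! ### §12 Cells of columns, generated as bitsets -/

/-- One step of the layer recursion: from the list `[E(i,0), …, E(i,d)]` — `E(i,j)` the set of the
words `u · s`, `u` of length `i` with exactly `j` letters `y`, `s` in a seed set of words of length
`m` — to the same list for `i + 1`; `sh = 2^(m+i)` is the code of the new leading letter `y`, and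
`prev` is the preceding entry of the input list (`E(i,j-1)`, initially `0`). [folklore] -/
def layerStep (sh : ℕ) : List ℕ → ℕ → List ℕ
  | [], _ => []
  | e :: es, prev => (e ||| (prev <<< sh)) :: layerStep sh es e

/-- `n` layer steps, the current words having length `m + i`. [folklore] -/
def layers (m : ℕ) : ℕ → ℕ → List ℕ → List ℕ
  | 0, _, L => L
  | n + 1, i, L => layers m n (i + 1) (layerStep (2 ^ (m + i)) L 0)

/-- The set (bitset of codes) of the words `u · s`, `u` of length `n` with exactly `d` letters `y`,
`s` in the set `S` of words of length `m`. [folklore] -/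
def extendMask (m n d S : ℕ) : ℕ := (layers m n 0 (S :: List.replicate d 0)).getD d 0

/-- The code of the word with trailing parts `sfx = [ℓ₁, ℓ₂, …]` (`ℓ₁` the LAST part), i.e. of
`⋯ x^{ℓ₂-1} y x^{ℓ₁-1} y`, a word of length `sfx.sum`. [folklore] -/
def sfxCode : List ℕ → ℕ
  | [] => 0
  | l :: ls => sfxCode ls * 2 ^ l + 1

/-- **A cell**: the bitset of the codes of the admissible binary words of weight `k` (first letter
`x`, last letter `y`) of depth `D` whose trailing parts are `sfx` (last part first; `[]`: no
condition). For `sfx.length < D` these are the words `x · u · y · w(sfx)` with `u` of length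
`k - 2 - sfx.sum` carrying the remaining `D - 1 - sfx.length` letters `y`; for `sfx.length = D` it is
the single word `w(sfx)` when it has length `k` and first part `≥ 2`. (Hoffman words are NOT
removed here; `checkBlockC` intersects with `colMask`.) [folklore] -/
def cellMask (k D : ℕ) (sfx : List ℕ) : ℕ :=
  let m := sfx.sum
  let j := sfx.length
  bif j == D then (bif (m == k) && Nat.ble 2 (sfx.getLastD 1) then 2 ^ sfxCode sfx else 0) else
  bif Nat.blt j D && Nat.ble (m + 2) k then
    extendMask (m + 1) (k - 2 - m) (D - 1 - j) (2 ^ (2 ^ m + sfxCode sfx))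
  else 0

/-- The union of a list of cells `(D, sfx)`, as a bitset (tail-recursive fold). [folklore] -/
def cellsMask (k : ℕ) (cells : List (ℕ × List ℕ)) : ℕ :=
  cells.foldl (fun acc p => acc ||| cellMask k p.1 p.2) 0

/-! ### §13 Block certificates over cells -/

/-- **One block of a cell block certificate** in weight `k`: the block is the cells `cells`
(intersected with the columns), `later` a list of cells containing every later block of the chain;
the certificate lists the block's columns `L` — as a set EQUAL to the block (`maskOf L`), with
residues mod `W'` strictly increasing — and as many groups of valid row names, in pivot order;
no group row has a bit in the `later` cells (block triangularity), and the group rows masked to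
the block and XOR-folded into width `W'` eliminate fully along the relabelled columns
(`LinEDS.elimLoop`, as in §11). [cite: IharaKanekoZagier2006, Conjecture 1] -/
def checkBlockC (k W' f : ℕ) (cells later : List (ℕ × List ℕ)) (L : List ℕ)
    (groups : List (List (List ℕ × List ℕ))) : Bool :=
  let mask := cellsMask k cells &&& colMask k
  let higher := cellsMask k later
  let n := lengthTR L
  let rows := groups.map (rowBitsG k)
  Nat.beq (lengthTR groups) n && Nat.beq (maskOf L) mask && incMod W' L && Nat.blt n W' &&
    groups.all (fun g => g.all (validName k)) && rows.all (fun r => r &&& higher == 0) &&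
    elimLoop W' (rep W' n) (L.map (· % W')) (pack W' (rows.map fun r => xorFold W' f (r &&& mask)))

/-- **One cell block, encoded names** (each group a list of numerals, `decodeName`).
[cite: IharaKanekoZagier2006, Conjecture 1] -/
def checkBlockCEnc (k W' f : ℕ) (cells later : List (ℕ × List ℕ)) (L : List ℕ)
    (codes : List (List ℕ)) : Bool :=
  checkBlockC k W' f cells later L (codes.map fun g => g.map decodeName)

/-- OR of a list of bitsets. [folklore] -/
def orAll : List ℕ → ℕ
  | [] => 0
  | m :: ms => m ||| orAll ms

/-- Nesting along a chain of (block mask, later mask) pairs: every later block's mask lies inside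
the `later` mask of every earlier block. [folklore] -/
def chainNested : List (ℕ × ℕ) → Bool
  | [] => true
  | p :: rest => rest.all (fun q => Nat.beq (q.1 &&& p.2) q.1) && chainNested rest

/-- **The chain condition of a cell block certificate** in weight `k`, for the chain
`bl = [(cells₁, later₁), …]`: nesting (above) of the masks `cellsMask cellsᵢ ∧ colMask k`,
`cellsMask laterᵢ`, and the blocks together cover every column (`colMask k`). [folklore] -/
def chainOK (k : ℕ) (bl : List (List (ℕ × List ℕ) × List (ℕ × List ℕ))) : Bool :=
  let ms := bl.map fun p => (cellsMask k p.1 &&& colMask k, cellsMask k p.2)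
  chainNested ms && Nat.beq (orAll (ms.map Prod.fst)) (colMask k)

/-! ### §14 Elementary facts and sanity values -/

/-- Bits of `orAll`: some member has the bit. [folklore] -/
theorem testBit_orAll (i : ℕ) : ∀ ms : List ℕ, (orAll ms).testBit i = true ↔ ∃ m ∈ ms, m.testBit i = true
  | [] => by simp [orAll]
  | m :: ms => by
    rw [orAll, Nat.testBit_lor, Bool.or_eq_true, testBit_orAll i ms]
    simp

/-- `chainNested` unfolded: for every earlier/later pair along the list, the later mask lies inside
the earlier `later` mask. [folklore] -/
theorem chainNested_get : ∀ (ms : List (ℕ × ℕ)), chainNested ms = true →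
    ∀ (i j : Fin ms.length), i < j → (ms.get j).1 &&& (ms.get i).2 = (ms.get j).1
  | [], _, i, _, _ => i.elim0
  | p :: rest, h, ⟨i, hi⟩, ⟨j, hj⟩, hij => by
    rw [chainNested, Bool.and_eq_true, List.all_eq_true] at h
    cases j with
    | zero => exact absurd hij (by simp)
    | succ j' =>
      have hj' : j' < rest.length := by simpa using hj
      cases i with
      | zero =>
        have := h.1 _ (List.get_mem rest ⟨j', hj'⟩)
        simpa [Nat.beq_eq_true_eq] using this
      | succ i' =>
        have hi' : i' < rest.length := by simpa using hi
        exact chainNested_get rest h.2 ⟨i', hi'⟩ ⟨j', hj'⟩ (by simpa using hij)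

/-- Sanity (kernel), weight `5` (columns `1, 3, 7, 11, 13, 15` = `(5), (4,1), (3,1,1), (2,2,1),
(2,1,2), (2,1,1,1)`): the cells `(3,[1])`, `(3,[1,2])`, `(2,[1,4])`, `(1,[5])`, `(4,[])`; two values
of the generator; and a two-block cell certificate — block `{(5),(4,1)}` = cells `(1,[]),(2,[])`
with `later = (3,[]),(4,[])`, certified at width `5` by `F((2),(3)), F((4),(1))`, then block
`(3,[]),(4,[])` at width `7` — with its chain condition; the same blocks, encoded. [folklore] -/
theorem cells_sanity :
    cellMask 5 3 [1] = 2176 ∧ cellMask 5 3 [1, 2] = 2048 ∧ cellMask 5 2 [1, 4] = 8 ∧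
    cellMask 5 1 [5] = 2 ∧ cellMask 5 4 [] = 32768 ∧ sfxCode [1, 2, 3] = 11 ∧
    extendMask 2 3 1 (2 ^ 2) = 263232 ∧
    checkBlockC 5 5 3 [(1, []), (2, [])] [(3, []), (4, [])] [1, 3] [[([2], [3])], [([4], [1])]] = true ∧
    checkBlockC 5 7 2 [(3, []), (4, [])] [] [7, 15, 11, 13]
      [[([2, 1, 1], [1])], [([3, 1], [1])], [([2], [2, 1])], [([2], [1, 2])]] = true ∧
    chainOK 5 [([(1, []), (2, [])], [(3, []), (4, [])]), ([(3, []), (4, [])], [])] = true ∧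
    checkBlockCEnc 5 5 3 [(1, []), (2, [])] [(3, []), (4, [])] [1, 3] [[327689], [1114115]] = true ∧
    checkBlockCEnc 5 7 2 [(3, []), (4, [])] [] [7, 15, 11, 13]
      [[1507331], [1245187], [327691], [327693]] = true := by
  refine ⟨?_, ?_, ?_, ?_, ?_, ?_, ?_, ?_, ?_, ?_, ?_, ?_⟩ <;> decide +kernel

/-- Sanity (kernel), weight `17`: the cell `(9,[1,1])` (words of depth `9` ending in `y y`) has
`C(13,6) = 1716` members — here only a residue of its bitset is recorded — and a chain that does not
cover fails. [folklore] -/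
theorem cells_sanity_17 : cellMask 17 9 [1, 1] % 1000003 = 567972 ∧
    chainOK 5 [([(1, []), (2, [])], [(3, []), (4, [])])] = false := by
  refine ⟨?_, ?_⟩ <;> decide +kernel

/-! ### §15 Blocks with precomputed filler rows (provenance checked file by file)

Where the natural rows of a block are rank-deficient mod 2, the fillers are groups of hundreds to
thousands of plain rows (weight 17: the block of the columns of depth `≤ 5` needs `115` groups
totalling `≈ 4·10⁴` member rows; they are combinations of rows of total depth `6`, `7` and `8`
whose higher parts cancel). Recomputing all member rows inside ONE kernel run — and listing all
their names in ONE file — is too much for one gate slot and one file. So a block may carry, next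
to its groups of names, a list `extra` of PRECOMPUTED rows: each is given in block-local
coordinates (bit `j` ↔ the `j`-th listed column, `spread` back to codes by the kernel) and XOR-ed
onto the kernel-computed row of its group (`checkBlockCX`); that `extra[i]` IS the masked row of
some group of valid names with no bit in the later cells is the Boolean `checkExtra`, decided in as
many separate files as convenient and glued by `checkExtra_append`. The Summit-side master shows
`checkBlockCX ∧ checkExtra ⇒ checkBlockC` for the concatenated groups, so nothing new is trusted. -/

/-- Spread a bitset `ν` given in block-local coordinates over the listed columns `L`: bit `j` of
`ν` becomes bit `L[j]` (tail-recursive; `acc` accumulates). [folklore] -/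
def spread : List ℕ → ℕ → ℕ → ℕ
  | [], _, acc => acc
  | c :: cs, ν, acc => spread cs (ν / 2) (bif ν % 2 == 1 then acc ||| 2 ^ c else acc)

/-- The rows of a block with extras: the kernel-computed group row XOR the spread extra (an extra
`0` costs nothing). [folklore] -/
def rowsX (k : ℕ) (L : List ℕ) : List (List (List ℕ × List ℕ)) → List ℕ → List ℕ
  | g :: gs, e :: es => (bif e == 0 then rowBitsG k g else rowBitsG k g ^^^ spread L e 0) :: rowsX k L gs es
  | _, _ => []

/-- **One block of a cell block certificate with precomputed filler rows**: as `checkBlockC`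
(§13), the `i`-th row being `rowBitsG k groups[i] ^^^ spread L extra[i]`; the groups of names
are checked valid and free of the later cells here, the extras by `checkExtra`.
[cite: IharaKanekoZagier2006, Conjecture 1] -/
def checkBlockCX (k W' f : ℕ) (cells later : List (ℕ × List ℕ)) (L : List ℕ)
    (groups : List (List (List ℕ × List ℕ))) (extra : List ℕ) : Bool :=
  let mask := cellsMask k cells &&& colMask k
  let higher := cellsMask k later
  let n := lengthTR L
  let rows := rowsX k L groups extra
  Nat.beq (lengthTR groups) n && sameLength groups extra && Nat.beq (maskOf L) mask && incMod W' L &&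
    Nat.blt n W' && groups.all (fun g => g.all (validName k)) &&
    (groups.map (rowBitsG k)).all (fun r => r &&& higher == 0) &&
    elimLoop W' (rep W' n) (L.map (· % W')) (pack W' (rows.map fun r => xorFold W' f (r &&& mask)))

/-- **One cell block with extras, encoded names**. [cite: IharaKanekoZagier2006, Conjecture 1] -/
def checkBlockCXEnc (k W' f : ℕ) (cells later : List (ℕ × List ℕ)) (L : List ℕ)
    (codes : List (List ℕ)) (extra : List ℕ) : Bool :=
  checkBlockCX k W' f cells later L (codes.map fun g => g.map decodeName) extra

/-- Provenance of extras, given the two masks: every extra is the spread of the masked row of its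
group of valid names, which has no bit in the later cells. [cite: IharaKanekoZagier2006, §2] -/
def checkExtraAux (k mask higher : ℕ) (L : List ℕ) : List ℕ → List (List (List ℕ × List ℕ)) → Bool
  | [], [] => true
  | e :: es, g :: gs => (g.all (validName k) && (rowBitsG k g &&& higher == 0) &&
      Nat.beq (spread L e 0) (rowBitsG k g &&& mask)) && checkExtraAux k mask higher L es gs
  | _, _ => false

/-- **Provenance of precomputed filler rows** for the block `cells` (later cells `later`, listed
columns `L`) of weight `k`: `extra[i] ` spread over `L` is the row of the group `pgroups[i]` of
valid names masked to the block, and that row has no bit in the later cells.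
[cite: IharaKanekoZagier2006, §2] -/
def checkExtra (k : ℕ) (cells later : List (ℕ × List ℕ)) (L : List ℕ) (extra : List ℕ)
    (pgroups : List (List (List ℕ × List ℕ))) : Bool :=
  checkExtraAux k (cellsMask k cells &&& colMask k) (cellsMask k later) L extra pgroups

/-- **Provenance, encoded names**. [cite: IharaKanekoZagier2006, §2] -/
def checkExtraEnc (k : ℕ) (cells later : List (ℕ × List ℕ)) (L : List ℕ) (extra : List ℕ)
    (codes : List (List ℕ)) : Bool :=
  checkExtra k cells later L extra (codes.map fun g => g.map decodeName)

/-- Gluing provenance files: appending extras and their groups. [folklore] -/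
theorem checkExtraAux_append {k mask higher : ℕ} {L : List ℕ} :
    ∀ {es es' : List ℕ} {gs gs' : List (List (List ℕ × List ℕ))},
      checkExtraAux k mask higher L es gs = true → checkExtraAux k mask higher L es' gs' = true →
        checkExtraAux k mask higher L (es ++ es') (gs ++ gs') = true
  | [], [], gs, gs', h, h' => by
    cases gs with
    | nil => simpa using h'
    | cons g gs => simp [checkExtraAux] at h
  | [], e' :: es', gs, gs', h, h' => by
    cases gs with
    | nil => simpa using h'
    | cons g gs => simp [checkExtraAux] at h
  | e :: es, es', [], gs', h, h' => by simp [checkExtraAux] at h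
  | e :: es, es', g :: gs, gs', h, h' => by
    simp only [List.cons_append, checkExtraAux, Bool.and_eq_true] at h ⊢
    exact ⟨h.1, checkExtraAux_append h.2 h'⟩

/-- **Gluing provenance files** (the extras of a block may be certified in several files).
[folklore] -/
theorem checkExtra_append {k : ℕ} {cells later : List (ℕ × List ℕ)} {L : List ℕ}
    {es es' : List ℕ} {gs gs' : List (List (List ℕ × List ℕ))}
    (h : checkExtra k cells later L es gs = true) (h' : checkExtra k cells later L es' gs' = true) :
    checkExtra k cells later L (es ++ es') (gs ++ gs') = true :=
  checkExtraAux_append h h'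

/-- The empty provenance. [folklore] -/
theorem checkExtra_nil (k : ℕ) (cells later : List (ℕ × List ℕ)) (L : List ℕ) :
    checkExtra k cells later L [] [] = true := rfl

/-- Sanity (kernel), weight `5`, block `(3,[]),(4,[])` (columns `7, 15, 11, 13` in residue order mod
`7`): the same certificate as in `cells_sanity` with its second row `F((3,1),(1))` (bits `3, 7, 11`;
masked to the block `7, 11` = local bits `0, 2`, i.e. `ν = 5`) supplied as an extra on an empty
group, with its provenance; `spread`; and a failing provenance. [folklore] -/
theorem cellsX_sanity :
    spread [7, 15, 11, 13] 5 0 = 2 ^ 7 + 2 ^ 11 ∧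
    checkBlockCX 5 7 2 [(3, []), (4, [])] [] [7, 15, 11, 13]
      [[([2, 1, 1], [1])], [], [([2], [2, 1])], [([2], [1, 2])]] [0, 5, 0, 0] = true ∧
    checkExtra 5 [(3, []), (4, [])] [] [7, 15, 11, 13] [5] [[([3, 1], [1])]] = true ∧
    checkExtra 5 [(3, []), (4, [])] [] [7, 15, 11, 13] [7] [[([3, 1], [1])]] = false ∧
    checkBlockCXEnc 5 7 2 [(3, []), (4, [])] [] [7, 15, 11, 13]
      [[1507331], [], [327691], [327693]] [0, 5, 0, 0] = true ∧
    checkExtraEnc 5 [(3, []), (4, [])] [] [7, 15, 11, 13] [5] [[1245187]] = true := by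
  refine ⟨?_, ?_, ?_, ?_, ?_, ?_⟩ <;> decide +kernel

/-! ### §16 Provenance with the empty entries short-circuited

In a block with extras most entries are plain rows: extra `0` on a singleton group, provenance
group `[]`. `checkExtra` (§15) evaluates `spread L 0 0` for each of them — a walk over the whole
column list, `n` times. `checkExtraZ` short-circuits these entries (an extra `0` must come with
the empty provenance group) and IMPLIES `checkExtra` (`checkExtra_of_checkExtraZ`), so provenance
files decide `checkExtraZ` and conclude `checkExtra`. -/

/-- Provenance given the two masks, empty entries short-circuited. [folklore] -/
def checkExtraZAux (k mask higher : ℕ) (L : List ℕ) : List ℕ → List (List (List ℕ × List ℕ)) → Bool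
  | [], [] => true
  | e :: es, g :: gs => (bif e == 0 then g.isEmpty else
      (g.all (validName k) && (rowBitsG k g &&& higher == 0) &&
        Nat.beq (spread L e 0) (rowBitsG k g &&& mask))) && checkExtraZAux k mask higher L es gs
  | _, _ => false

/-- **Provenance of precomputed filler rows, empty entries short-circuited** (see `checkExtra`).
[cite: IharaKanekoZagier2006, §2] -/
def checkExtraZ (k : ℕ) (cells later : List (ℕ × List ℕ)) (L : List ℕ) (extra : List ℕ)
    (pgroups : List (List (List ℕ × List ℕ))) : Bool :=
  checkExtraZAux k (cellsMask k cells &&& colMask k) (cellsMask k later) L extra pgroups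

/-- **The same, encoded names**. [cite: IharaKanekoZagier2006, §2] -/
def checkExtraZEnc (k : ℕ) (cells later : List (ℕ × List ℕ)) (L : List ℕ) (extra : List ℕ)
    (codes : List (List ℕ)) : Bool :=
  checkExtraZ k cells later L extra (codes.map fun g => g.map decodeName)

/-- Spreading the empty bitset adds nothing. [folklore] -/
theorem spread_zero : ∀ (L : List ℕ) (acc : ℕ), spread L 0 acc = acc
  | [], _ => rfl
  | c :: cs, acc => by rw [spread]; exact spread_zero cs acc

/-- The short-circuited provenance implies the plain one, entry by entry. [folklore] -/
theorem checkExtraZAux_imp {k mask higher : ℕ} {L : List ℕ} :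
    ∀ {es : List ℕ} {gs : List (List (List ℕ × List ℕ))},
      checkExtraZAux k mask higher L es gs = true → checkExtraAux k mask higher L es gs = true
  | [], [], _ => rfl
  | [], _ :: _, h => by simp [checkExtraZAux] at h
  | _ :: _, [], h => by simp [checkExtraZAux] at h
  | e :: es, g :: gs, h => by
    simp only [checkExtraZAux, Bool.and_eq_true] at h
    simp only [checkExtraAux, Bool.and_eq_true]
    refine ⟨?_, checkExtraZAux_imp h.2⟩
    cases he : (e == 0)
    · rw [he] at h; simpa [Bool.and_eq_true] using h.1
    · have he0 : e = 0 := by simpa using he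
      subst he0
      rw [he] at h
      have hg : g = [] := by simpa [List.isEmpty_iff] using h.1
      subst hg
      simp [rowBitsG, xorAll, spread_zero]

/-- **`checkExtraZ ⇒ checkExtra`**. [folklore] -/
theorem checkExtra_of_checkExtraZ {k : ℕ} {cells later : List (ℕ × List ℕ)} {L : List ℕ}
    {extra : List ℕ} {pgroups : List (List (List ℕ × List ℕ))}
    (h : checkExtraZ k cells later L extra pgroups = true) :
    checkExtra k cells later L extra pgroups = true :=
  checkExtraZAux_imp h

/-- Sanity (kernel), the weight-`5` example of `cellsX_sanity` in full alignment: four entries,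
the second a genuine extra, the others empty; a misaligned one fails. [folklore] -/
theorem cellsZ_sanity :
    checkExtraZ 5 [(3, []), (4, [])] [] [7, 15, 11, 13] [0, 5, 0, 0] [[], [([3, 1], [1])], [], []] = true ∧
    checkExtraZ 5 [(3, []), (4, [])] [] [7, 15, 11, 13] [0, 5, 0, 0] [[([2], [3])], [([3, 1], [1])], [], []] = false ∧
    checkExtraZEnc 5 [(3, []), (4, [])] [] [7, 15, 11, 13] [0, 5, 0, 0] [[], [1245187], [], []] = true := by
  refine ⟨?_, ?_, ?_⟩ <;> decide +kernel

/-! ### §17 Wider name codes (weights ≥ 18)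

`LinEDS.decodeName` packs a row name `(s,t)` as `enc s · 2^16 + enc t` with `enc t = 2^(wt t) + code (bw t)`,
so `wt t ≤ 15`: enough for weight `17` (`wt s ≥ 2`), not for weight `18`. `decodeName2` uses the shift
`2^20` (both weights up to `19`); the `…Enc2` checks are the §13/§15/§16 checks on names so encoded. -/

/-- A row name `(s, t)` encoded by one numeral `enc s · 2^20 + enc t`. [folklore] -/
def decodeName2 (N : ℕ) : List ℕ × List ℕ := (decodeIdx (N / 2 ^ 20), decodeIdx (N % 2 ^ 20))

/-- **One cell block, names encoded with `decodeName2`**. [cite: IharaKanekoZagier2006, Conjecture 1] -/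
def checkBlockCEnc2 (k W' f : ℕ) (cells later : List (ℕ × List ℕ)) (L : List ℕ)
    (codes : List (List ℕ)) : Bool :=
  checkBlockC k W' f cells later L (codes.map fun g => g.map decodeName2)

/-- **One cell block with extras, names encoded with `decodeName2`**.
[cite: IharaKanekoZagier2006, Conjecture 1] -/
def checkBlockCXEnc2 (k W' f : ℕ) (cells later : List (ℕ × List ℕ)) (L : List ℕ)
    (codes : List (List ℕ)) (extra : List ℕ) : Bool :=
  checkBlockCX k W' f cells later L (codes.map fun g => g.map decodeName2) extra

/-- **Short-circuited provenance, names encoded with `decodeName2`**. [cite: IharaKanekoZagier2006, §2] -/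
def checkExtraZEnc2 (k : ℕ) (cells later : List (ℕ × List ℕ)) (L : List ℕ) (extra : List ℕ)
    (codes : List (List ℕ)) : Bool :=
  checkExtraZ k cells later L extra (codes.map fun g => g.map decodeName2)

/-- Sanity (kernel): `decodeName2` on the encodings of `((2),(1))` and `((2,1),(3))`, and the weight-5
two-block certificate of `cells_sanity` once more with the wide codes. [folklore] -/
theorem cells2_sanity : decodeName2 (5 * 2 ^ 20 + 3) = ([2], [1]) ∧
    decodeName2 (11 * 2 ^ 20 + 9) = ([2, 1], [3]) ∧
    checkBlockCEnc2 5 5 3 [(1, []), (2, [])] [(3, []), (4, [])] [1, 3]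
      [[5 * 2 ^ 20 + 9], [17 * 2 ^ 20 + 3]] = true ∧
    checkBlockCXEnc2 5 7 2 [(3, []), (4, [])] [] [7, 15, 11, 13]
      [[23 * 2 ^ 20 + 3], [], [5 * 2 ^ 20 + 11], [5 * 2 ^ 20 + 13]] [0, 5, 0, 0] = true ∧
    checkExtraZEnc2 5 [(3, []), (4, [])] [] [7, 15, 11, 13] [0, 5, 0, 0] [[], [19 * 2 ^ 20 + 3], [], []] = true := by
  refine ⟨?_, ?_, ?_, ?_, ?_⟩ <;> decide +kernel

end LinEDS

end Literature.NumberTheory.Transcendental
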